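import Summits.HodgeConjecture.HodgeConjecture.Theorems.EightfoldBlochSeedsBlochSeedsGenericCarrierCoordinates
import Literature.AlgebraicGeometry.HodgeTheory.WeilClassesPolarizationOrthogonal
import Literature.AlgebraicGeometry.HodgeTheory.WeilClassesDescendingAssembly
import Literature.AlgebraicGeometry.HodgeTheory.ExpTwistClassesExponentialLaw
import HarnessLib

/-!
# Route `EightfoldBlochSeeds`, cruxes `BlochSeedsGeneric` (item stmt-HodgeConjecture-18880) / `BlochSeedDiscThree` (18882), line
# `pad4-cm-anchor`, stubs `stub_pad4_carrier` / `stub_rung_pad4_seedAt`: TWO EXACT NECESSARY TESTS ON A CANDIDATE CARRIER CLASS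
# `x = q·h_Kⁿ + w` — the Lefschetz shadow `h_Kʲ ⌣ x = q·h_K^{j+n}` and the `K`-shape polynomial `P_shape((x₀·𝟙 + φ)^*) x = 0` —
# every `d ≥ 1`, every `(A, φ)` with `φ² = -d`

HONEST FRAMING. Nothing here proves either stub, either crux, rung H2, HC_AV or the Hodge conjecture; nothing is constructed.
UNCONDITIONAL `--supports` lemmas (no named fact as hypothesis, no definition, no Literature fact; D-0026). Census-neutral.

WHAT IS HERE (leafhand `leafhand-hodge-eightfoldblochseed-1-g1`). A designer for the `pad4-cm-anchor` lines must certify that the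
class `x = cl(Z)` (lci door) or `x = c₄(𝓔)` (sheaf door) of a candidate has the SHAPE `q·h_Kⁿ + w`, `w` in the Weil plane. The `d = 1`
cell typed two exact, period-free necessary tests for this at `d = 1` in a frame (`Cruxes/BlochSeedDiscOne/SeedCheckerPrimitive.lean`
§16.5, `ShapeAt.cupProduct_hPow` and `aeval_shapePoly_eq_zero_of_shapeAt`; not importable from `Theorems/`). This file proves their
`d`-UNIFORM, frame-free forms on any complex abelian variety `A` of dimension `2n` with `φ ≫ φ = -d`:

* §1 `hPow_cupProduct_carrierClass` — **LEFSCHETZ SHADOW**: for a `K`-symmetric `h` (`φ^*h = d·h`; e.g. `h_K = d·c + φ^*c`, the tree's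
  `map_ksymm_eq_smul`) and `w` in the Weil plane, `hʲ ⌣ (q·hⁿ + w) = q·h^{j+n}` for every `j ≥ 1` (the Weil plane is `h`-primitive:
  the tree's `cupProduct_cupPowTwo_eq_zero_of_map_eq_smul_of_mem_weilClassesOf`). At `j = n`: `hⁿ ⌣ x = q·h^{2n}` — the degree reads
  `q` (and ONLY `q`: the Weil coordinate is invisible to every `h`-number); `carrierClass_q_eq_zero_iff` — for `h^{2n} ≠ 0`,
  `q = 0 ↔ hⁿ ⌣ x = 0`.
* §2 `aeval_shapePoly_carrierClass_eq_zero` — **THE `K`-SHAPE POLYNOMIAL KILLS A CARRIER CLASS**: for a balanced `h ∈ χ_{1,1}`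
  (`ksymm_mem_pullbackEigenclasses_one_one`: every `h_K`), `w` in the Weil plane, ONE test isogeny `T = (x₀·𝟙 + φ)^*` on `H²ⁿ` and the
  cubic `P = (X − χ_{n,n}(x₀,1))·(X − χ_{2n,0}(x₀,1))·(X − χ_{0,2n}(x₀,1))`, `χ_{a,b}(x,y) = (x + iy√d)ᵃ(x − iy√d)ᵇ`: `P(T)(q·hⁿ + w) = 0`
  (`hⁿ ∈ χ_{n,n}`, `w ∈ E₊ ⊕ E₋ = χ_{2n,0} ⊕ χ_{0,2n}`, and `T` acts on `χ_{a,b}` by `χ_{a,b}(x₀, 1)`). For `cl(Z)` this is a statement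
  about three push–pull classes `Tⁱ cl(Z)`, `i ≤ 3` — an exact necessary test computable on a presentation, for every `d`.

## References

[cite: vanGeemen1994HodgeAV, 4.8–4.9, Lemma 5.2 (1), (6) and proof of Thm. 6.12] [cite: HatcherAT2002, §3.2 Prop. 3.10 and p. 211]
[cite: Thomas2005Nodes, §4]
-/

noncomputable section

-- single-problem summit (Problem = Summit): the mandated namespace repeats `HodgeConjecture`.
set_option linter.dupNamespace false

open CategoryTheory AlgebraicGeometry Polynomial
open Literature.AlgebraicGeometry Literature.AlgebraicGeometry.Motives Literature.AlgebraicGeometry.HodgeTheory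
open Literature.AlgebraicTopology.SingularHomology

namespace Summit.HodgeConjecture.HodgeConjecture.Theorems

variable {A : AbelianVariety ℂ} {φ : A ⟶ A} {n d : ℕ}

/-! ## §1 The Lefschetz shadow of a carrier class -/

section Lefschetz

/-- **LEFSCHETZ SHADOW `hʲ ⌣ (q·hⁿ + w) = q·h^{j+n}`** (`j ≥ 1`) on an abelian `2n`-fold with `φ ≫ φ = -d`, `d ≥ 1`, for a
`K`-symmetric class `h` (`φ^*h = d·h`) and `w` in the Weil plane: `hʲ ⌣ hⁿ = h^{j+n}` (`cupProduct_cupPowTwo_cupPowTwo`) and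
`hʲ ⌣ w = 0` (the Weil plane is `h`-primitive, `cupProduct_cupPowTwo_eq_zero_of_map_eq_smul_of_mem_weilClassesOf`). The `d`-uniform,
frame-free form of the `d = 1` cell's `ShapeAt.cupProduct_hPow`. [cite: vanGeemen1994HodgeAV, proof of Lemma 5.2 (6) and of Thm. 6.12]
[cite: HatcherAT2002, §3.2 p. 211] -/
theorem hPow_cupProduct_carrierClass (hA : A.dim = 2 * n) (hd : 0 < d) (hφ : φ ≫ φ = -(d • 𝟙 A)) {h : complexBetti A.X 2}
    (hh : complexBetti.map φ.hom.hom.hom 2 h = (d : ℂ) • h) {w : complexBetti A.X (2 * n)} (hw : w ∈ weilClassesOf A φ n d)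
    (q : ℂ) {j : ℕ} (hj : 0 < j) {m : ℕ} (hm : j + n = m) (hs : 2 * j + 2 * n = 2 * m) :
    cupProduct hs (cupPowTwo h j) (q • cupPowTwo h n + w) = q • cupPowTwo h m := by
  rw [map_add, map_smul, cupProduct_cupPowTwo_cupPowTwo h hm hs,
    cupProduct_cupPowTwo_eq_zero_of_map_eq_smul_of_mem_weilClassesOf hA hd hφ hh hw hj hs, add_zero]

/-- **The degree reads `q`: `hⁿ ⌣ (q·hⁿ + w) = q·h²ⁿ`** (`n ≥ 1`; the case `j = n` of `hPow_cupProduct_carrierClass`). For a carrier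
`Z` with `cl(Z) = q·h_Kⁿ + w` this is `deg_{h_K}(Z) = q·h_K^{2n}`, so `q ≠ 0` as soon as the degree is non-zero — the Weil coordinate
`w` contributes nothing to any `h`-number. [cite: vanGeemen1994HodgeAV, proof of Thm. 6.12] -/
theorem hPowHalf_cupProduct_carrierClass (hA : A.dim = 2 * n) (hn : 0 < n) (hd : 0 < d) (hφ : φ ≫ φ = -(d • 𝟙 A))
    {h : complexBetti A.X 2} (hh : complexBetti.map φ.hom.hom.hom 2 h = (d : ℂ) • h) {w : complexBetti A.X (2 * n)}
    (hw : w ∈ weilClassesOf A φ n d) (q : ℂ) (hs : 2 * n + 2 * n = 2 * (2 * n)) :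
    cupProduct hs (cupPowTwo h n) (q • cupPowTwo h n + w) = q • cupPowTwo h (2 * n) :=
  hPow_cupProduct_carrierClass hA hd hφ hh hw q hn (by ring) hs

/-- **`q = 0 ↔ hⁿ ⌣ x = 0`** for a carrier-shaped class `x = q·hⁿ + w` when `h²ⁿ ≠ 0` (`n ≥ 1`): the `ℚ[h]`-coordinate of `x` is
decided by ONE cup product. [cite: vanGeemen1994HodgeAV, proof of Thm. 6.12] -/
theorem carrierClass_q_eq_zero_iff (hA : A.dim = 2 * n) (hn : 0 < n) (hd : 0 < d) (hφ : φ ≫ φ = -(d • 𝟙 A))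
    {h : complexBetti A.X 2} (hh : complexBetti.map φ.hom.hom.hom 2 h = (d : ℂ) • h) (h2n : cupPowTwo h (2 * n) ≠ 0)
    {w : complexBetti A.X (2 * n)} (hw : w ∈ weilClassesOf A φ n d) (q : ℂ) (hs : 2 * n + 2 * n = 2 * (2 * n)) :
    q = 0 ↔ cupProduct hs (cupPowTwo h n) (q • cupPowTwo h n + w) = 0 := by
  rw [hPowHalf_cupProduct_carrierClass hA hn hd hφ hh hw q hs, smul_eq_zero, or_iff_left h2n]

/-- **The stubs' instance of the shadow**: for `h_K = d·c + φ^*c` (ANY `c ∈ H²`; in the stubs `c = e^*a`), which is `K`-symmetric by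
the tree's `map_ksymm_eq_smul`, `h_Kʲ ⌣ (q·h_Kⁿ + w) = q·h_K^{j+n}` for every `j ≥ 1`. [cite: vanGeemen1994HodgeAV, Lemma 5.2 (1) and (6)] -/
theorem hPow_cupProduct_carrierClass_ksymm (hA : A.dim = 2 * n) (hd : 0 < d) (hφ : φ ≫ φ = -(d • 𝟙 A)) (c : complexBetti A.X 2)
    {w : complexBetti A.X (2 * n)} (hw : w ∈ weilClassesOf A φ n d) (q : ℂ) {j : ℕ} (hj : 0 < j) {m : ℕ} (hm : j + n = m)
    (hs : 2 * j + 2 * n = 2 * m) :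
    cupProduct hs (cupPowTwo ((d : ℂ) • c + complexBetti.map φ.hom.hom.hom 2 c) j)
        (q • cupPowTwo ((d : ℂ) • c + complexBetti.map φ.hom.hom.hom 2 c) n + w) =
      q • cupPowTwo ((d : ℂ) • c + complexBetti.map φ.hom.hom.hom 2 c) m :=
  hPow_cupProduct_carrierClass hA hd hφ (map_ksymm_eq_smul hφ c) hw q hj hm hs

end Lefschetz

/-! ## §2 The `K`-shape polynomial kills a carrier class -/

section ShapePoly

/-- A polynomial in an endomorphism acts on an eigenvector by evaluation at the eigenvalue (zero vector included). [folklore] -/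
theorem aeval_apply_of_mem_eigenspace_end {M : Type*} [AddCommGroup M] [Module ℂ M] {f : Module.End ℂ M} {μ : ℂ} {z : M}
    (hz : z ∈ f.eigenspace μ) (g : ℂ[X]) : aeval f g z = g.eval μ • z := by
  by_cases h0 : z = 0
  · rw [h0, map_zero, smul_zero]
  · exact Module.End.aeval_apply_of_hasEigenvector (Module.End.hasEigenvector_iff.2 ⟨hz, h0⟩)

/-- **THE `K`-SHAPE POLYNOMIAL KILLS EVERY CARRIER-SHAPED CLASS** (exact, period-free, every `d ≥ 1`). On an abelian variety `A`
with `φ ≫ φ = -d`, let `h ∈ H²` be balanced (`h ∈ χ_{1,1}`, e.g. `h_K = d·c + φ^*c` by `ksymm_mem_pullbackEigenclasses_one_one`) and `w`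
in the Weil plane `weilClassesOf A φ n d = E₊ ⊕ E₋`. For ONE test isogeny `T = (x₀·𝟙 + φ)^*` on `H²ⁿ(A(ℂ); ℂ)` and the cubic
`P = (X − χ_{n,n}(x₀,1))·((X − χ_{2n,0}(x₀,1))·(X − χ_{0,2n}(x₀,1)))`, `χ_{a,b}(x, y) = (x + iy√d)ᵃ(x − iy√d)ᵇ`:
`P(T)(q·hⁿ + w) = 0` — `hⁿ ∈ χ_{n,n}` (`cupPowTwo_mem_pullbackEigenclasses_diag`), `w = w₊ + w₋` with `w₊ ∈ χ_{2n,0}`, `w₋ ∈ χ_{0,2n}`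
(`mem_weilClassesPlus_iff` / `mem_weilClassesMinus_iff`), and `T` acts on `χ_{a,b}` by the scalar `χ_{a,b}(x₀, 1)`
(`pullbackEigenclasses_le_eigenspace`), so each of the three summands is killed by its own linear factor. The `d`-uniform form of the
`d = 1` cell's `aeval_shapePoly_eq_zero_of_shapeAt`. [cite: vanGeemen1994HodgeAV, 4.8–4.9 and proof of Thm. 6.12] [cite: Thomas2005Nodes, §4] -/
theorem aeval_shapePoly_carrierClass_eq_zero {h : complexBetti A.X 2}
    (hh : h ∈ pullbackEigenclasses A φ 2 (fun x y =>
      ((x : ℂ) + (y : ℂ) * Complex.I * (Real.sqrt d : ℂ)) ^ 1 * ((x : ℂ) - (y : ℂ) * Complex.I * (Real.sqrt d : ℂ)) ^ 1))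
    {w : complexBetti A.X (2 * n)} (hw : w ∈ weilClassesOf A φ n d) (q : ℂ) (x₀ : ℕ) :
    aeval (complexBetti.map (x₀ • 𝟙 A + (1 : ℕ) • φ).hom.hom.hom (2 * n)).hom
        ((X - C (((x₀ : ℂ) + ((1 : ℕ) : ℂ) * Complex.I * (Real.sqrt d : ℂ)) ^ n *
            ((x₀ : ℂ) - ((1 : ℕ) : ℂ) * Complex.I * (Real.sqrt d : ℂ)) ^ n)) *
          ((X - C (((x₀ : ℂ) + ((1 : ℕ) : ℂ) * Complex.I * (Real.sqrt d : ℂ)) ^ (2 * n) *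
              ((x₀ : ℂ) - ((1 : ℕ) : ℂ) * Complex.I * (Real.sqrt d : ℂ)) ^ 0)) *
            (X - C (((x₀ : ℂ) + ((1 : ℕ) : ℂ) * Complex.I * (Real.sqrt d : ℂ)) ^ 0 *
              ((x₀ : ℂ) - ((1 : ℕ) : ℂ) * Complex.I * (Real.sqrt d : ℂ)) ^ (2 * n)))))
        (q • cupPowTwo h n + w) = 0 := by
  obtain ⟨w₁, hw₁, w₂, hw₂, rfl⟩ := Submodule.mem_sup.mp hw
  -- the three eigen-memberships for the test pull-back `T = (x₀·𝟙 + 1·φ)^*`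
  have e₁ := aeval_apply_of_mem_eigenspace_end
    (pullbackEigenclasses_le_eigenspace φ (2 * n) _ x₀ 1
      (Submodule.smul_mem _ q (cupPowTwo_mem_pullbackEigenclasses_diag hh n)))
  have hplus : w₁ ∈ pullbackEigenclasses A φ (2 * n) (fun x y =>
      ((x : ℂ) + (y : ℂ) * Complex.I * (Real.sqrt d : ℂ)) ^ (2 * n) * ((x : ℂ) - (y : ℂ) * Complex.I * (Real.sqrt d : ℂ)) ^ 0) := by
    rw [mem_pullbackEigenclasses_iff]
    intro x y
    rw [(mem_weilClassesPlus_iff.mp hw₁) x y, pow_zero, mul_one]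
  have hminus : w₂ ∈ pullbackEigenclasses A φ (2 * n) (fun x y =>
      ((x : ℂ) + (y : ℂ) * Complex.I * (Real.sqrt d : ℂ)) ^ 0 * ((x : ℂ) - (y : ℂ) * Complex.I * (Real.sqrt d : ℂ)) ^ (2 * n)) := by
    rw [mem_pullbackEigenclasses_iff]
    intro x y
    rw [(mem_weilClassesMinus_iff.mp hw₂) x y, pow_zero, one_mul]
  have e₂ := aeval_apply_of_mem_eigenspace_end (pullbackEigenclasses_le_eigenspace φ (2 * n) _ x₀ 1 hplus)
  have e₃ := aeval_apply_of_mem_eigenspace_end (pullbackEigenclasses_le_eigenspace φ (2 * n) _ x₀ 1 hminus)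
  rw [map_add, map_add, e₁, e₂, e₃]
  simp only [eval_mul, eval_sub, eval_X, eval_C, sub_self, zero_mul, mul_zero, zero_smul, add_zero]

/-- **The stubs' instance**: the shape polynomial kills `q·h_Kⁿ + w` for `h_K = d·c + φ^*c`, ANY `c ∈ H²` (in the stubs `c = e^*a`),
`φ ≫ φ = -d`, `d ≥ 1`. [cite: vanGeemen1994HodgeAV, Lemma 5.2 (1) and proof of Thm. 6.12] -/
theorem aeval_shapePoly_carrierClass_ksymm_eq_zero (hd : 0 < d) (hφ : φ ≫ φ = -(d • 𝟙 A)) (c : complexBetti A.X 2)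
    {w : complexBetti A.X (2 * n)} (hw : w ∈ weilClassesOf A φ n d) (q : ℂ) (x₀ : ℕ) :
    aeval (complexBetti.map (x₀ • 𝟙 A + (1 : ℕ) • φ).hom.hom.hom (2 * n)).hom
        ((X - C (((x₀ : ℂ) + ((1 : ℕ) : ℂ) * Complex.I * (Real.sqrt d : ℂ)) ^ n *
            ((x₀ : ℂ) - ((1 : ℕ) : ℂ) * Complex.I * (Real.sqrt d : ℂ)) ^ n)) *
          ((X - C (((x₀ : ℂ) + ((1 : ℕ) : ℂ) * Complex.I * (Real.sqrt d : ℂ)) ^ (2 * n) *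
              ((x₀ : ℂ) - ((1 : ℕ) : ℂ) * Complex.I * (Real.sqrt d : ℂ)) ^ 0)) *
            (X - C (((x₀ : ℂ) + ((1 : ℕ) : ℂ) * Complex.I * (Real.sqrt d : ℂ)) ^ 0 *
              ((x₀ : ℂ) - ((1 : ℕ) : ℂ) * Complex.I * (Real.sqrt d : ℂ)) ^ (2 * n)))))
        (q • cupPowTwo ((d : ℂ) • c + complexBetti.map φ.hom.hom.hom 2 c) n + w) = 0 :=
  aeval_shapePoly_carrierClass_eq_zero (ksymm_mem_pullbackEigenclasses_one_one hd hφ c) hw q x₀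

end ShapePoly

end Summit.HodgeConjecture.HodgeConjecture.Theorems

end
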